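import Literature.Geometry.Riemannian.GurskyViaclovskyLinearisationChart
import Literature.Analysis.FunctionSpaces.HolderManifoldSchauder
import Literature.Analysis.FunctionSpaces.HolderManifoldModelEllipticity
import Literature.Analysis.FunctionSpaces.HolderManifoldNemytskii
import Literature.Analysis.FunctionSpaces.HolderManifoldRegularity
import HarnessLib

/-!
# Helper `helper_linearisedChartRep` (O2a): the Schauder input package of the linearised
# Gursky–Viaclovsky path operator on `C^{2,α}_𝔄(M)`

Line `margerin-cone-hamilton-rails` of crux `EntropyRung.ChangGurskyYang`
(stmt-SmoothPoincare4-10834), registered helper stub `helper_linearisedChartRep` feeding stub O2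
(`stub_linearisedInvertible_of_chartRep`). On a closed Riemannian `4`-manifold with Hölder chart
data `𝔄`, `0 < α < 1`, a smooth positive `q`, `t ≤ 1` and a SMOOTH admissible solution `w` of
`backgroundPathOperator g t w = q e^{−4w}` (`backgroundScalar g w > 0`), the operator
`−(𝓛_{t,w} + 4q e^{−4w})` — minus the linearisation of `w ↦ F_t(w) − q e^{−4w}`
(`GurskyViaclovskyLinearisation.linearisedBackgroundOperator`), realised by ANY bounded
`L' : C^{2,α}_𝔄 →L C^{0,α}_𝔄` acting pointwise as the linearisation — has, chart by chart, the
representation `ρ̂_j · (Σ a_j^{ii'} D_{ii'} ũ_j + Σ b_jˡ D_l ũ_j + c_j ũ_j)` with symmetric,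
uniformly elliptic, bounded, Hölder coefficients on the `ρ₁`-thickenings of the chart pieces:
literally the hypothesis list of the tree's global Schauder estimate
`Literature.Analysis.FunctionSpaces.exists_schauder_global` for `Lop := −L'`.

Assembly of landed Literature pieces:

* per chart centre, `exists_linearised_chartRep` (`GurskyViaclovskyLinearisationChart.lean`):
  coefficients `A_j, B_j, C_j` smooth on the chart target, `A_j` symmetric and positive definite
  there, with `−(𝓛u + 4qe^{−4w}u)(chart_j⁻¹ y) = Σ A D²û + Σ B Dû + C û`, `û = u ∘ chart_j⁻¹`, for
  every `u ∈ C²(M)` (members of `C^{2,α}_𝔄` are `C²`, `HolderManifoldFunction.contMDiff`);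
* a common plateau radius `ρ₁` of the chart cutoffs `η_j`
  (`HolderChartData.exists_cthickening_cutoff_eq_one`): the closed `ρ₁`-thickenings `K'_j` of
  `chart_j(tsupport ρ_j)` are compact subsets of the targets on which `η_j = 1`;
* the coefficients `η_j A_j, η_j B_j, η_j C_j` are globally smooth with compact support, hence
  bounded and Hölder (`exists_bound_holderWith_of_hasCompactSupport`); uniform ellipticity on
  `K'_j` by compactness (`exists_ellipticity_const_of_continuousOn`), the upper bound from the
  coefficient bound (`quadratic_le_card_mul_of_abs_le`);
* the representation of the chart pieces: `piece ((−L')u) j y = ρ_j(x)·(−L'u)(x)`, `x = chart_j⁻¹ y`,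
  and near `y` the chart restriction `ũ_j = η_j·(u ∘ chart_j⁻¹)` IS `u ∘ chart_j⁻¹` whenever
  `ρ_j(x) ≠ 0` (`chartRestrictCLM_eventuallyEq`), so its value and first two derivatives at `y`
  are those of `û`.

## References

* M. J. Gursky, J. A. Viaclovsky, J. Differential Geom. 63 (2003) 131–154, §2 (proof of
  Prop. 2), §5. [GurskyViaclovsky2003]
* D. Gilbarg, N. S. Trudinger, *Elliptic Partial Differential Equations of Second Order* (2001),
  Thm. 6.2, §6.1. [GilbargTrudinger2001]
-/

noncomputable section

set_option linter.dupNamespace false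

open Set Function Filter
open scoped Manifold ContDiff Topology NNReal
open Literature.Analysis.FunctionSpaces Literature.Geometry.Riemannian
open Literature.Geometry.Riemannian.GurskyViaclovskyPath
open Literature.Geometry.Lorentzian Literature.Geometry.Lorentzian.PseudoRiemannianMetric

namespace Summit.SmoothPoincare4.SmoothPoincare4.Theorems.MargerinRails

set_option maxHeartbeats 800000 in
-- many opaque constants and a long conjunction
/-- **HELPER O2a — THE SCHAUDER INPUT PACKAGE OF `−(𝓛_{t,w} + 4q e^{−4w})`** at a smooth
admissible solution `w` with `t ≤ 1` (registered signature of the skeleton, verbatim): chart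
coefficients `a, b, c` for every chart of `𝔄`, a plateau radius `ρ₁`, ellipticity constants
`0 < l ≤ L` and sup/Hölder constants `Ka, Kb, Kc` on the `ρ₁`-thickenings of the chart pieces,
and the chart-piece representation of `(−L') u` for every bounded `L'` acting pointwise as
`𝓛_{t,w} + 4q e^{−4w}` — the hypotheses of `exists_schauder_global` for `Lop := −L'`. See the
module docstring for the assembly. [cite: GurskyViaclovsky2003, §2, proof of Prop. 2] -/
theorem helper_linearisedChartRep :
    ∀ (M : Type) [TopologicalSpace M] [T2Space M] [ChartedSpace (EuclideanSpace ℝ (Fin 4)) M]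
      [IsManifold (modelWithCornersSelf ℝ (EuclideanSpace ℝ (Fin 4))) ((⊤ : ℕ∞) : WithTop ℕ∞) M]
      [CompactSpace M] {ι : Type} [Fintype ι]
      (𝔄 : Literature.Analysis.FunctionSpaces.HolderChartData ι (EuclideanSpace ℝ (Fin 4)) M)
      (g : Literature.Geometry.Lorentzian.PseudoRiemannianMetric
        (modelWithCornersSelf ℝ (EuclideanSpace ℝ (Fin 4))) ((⊤ : ℕ∞) : WithTop ℕ∞)
        (EuclideanSpace ℝ (Fin 4))
        (TangentSpace (modelWithCornersSelf ℝ (EuclideanSpace ℝ (Fin 4))) : M → Type _))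
      [g.HasLeviCivita], g.IsRiemannian →
      ∀ (q : M → ℝ), ContMDiff (modelWithCornersSelf ℝ (EuclideanSpace ℝ (Fin 4)))
        (modelWithCornersSelf ℝ ℝ) ((⊤ : ℕ∞) : WithTop ℕ∞) q → (∀ x, 0 < q x) →
      ∀ {α : NNReal}, 0 < α → ∀ (hα1 : α < 1) (t : ℝ), t ≤ 1 →
      ∀ (w : M → ℝ), ContMDiff (modelWithCornersSelf ℝ (EuclideanSpace ℝ (Fin 4)))
        (modelWithCornersSelf ℝ ℝ) ((⊤ : ℕ∞) : WithTop ℕ∞) w →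
      (∀ x, 0 < Literature.Geometry.Riemannian.GurskyViaclovskyPath.backgroundScalar g w x) →
      (∀ x, Literature.Geometry.Riemannian.GurskyViaclovskyPath.backgroundPathOperator g t w x =
        q x * Real.exp (-4 * w x)) →
      ∃ (a : ι → Fin 4 → Fin 4 → EuclideanSpace ℝ (Fin 4) → ℝ)
        (b : ι → Fin 4 → EuclideanSpace ℝ (Fin 4) → ℝ) (c : ι → EuclideanSpace ℝ (Fin 4) → ℝ)
        (ρ₁ l L : ℝ) (Ka Kb Kc : NNReal),
        0 < ρ₁ ∧ 0 < l ∧ (∀ j i i' x, a j i i' x = a j i' i x) ∧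
        (∀ j, ∀ x ∈ Metric.thickening ρ₁ (𝔄.chart j '' tsupport (𝔄.ρ j)), ∀ ξ : Fin 4 → ℝ,
          l * ∑ i, ξ i ^ 2 ≤ ∑ i, ∑ i', a j i i' x * ξ i * ξ i') ∧
        (∀ j, ∀ x ∈ Metric.thickening ρ₁ (𝔄.chart j '' tsupport (𝔄.ρ j)), ∀ ξ : Fin 4 → ℝ,
          ∑ i, ∑ i', a j i i' x * ξ i * ξ i' ≤ L * ∑ i, ξ i ^ 2) ∧
        (∀ j i i', ∀ x ∈ Metric.thickening ρ₁ (𝔄.chart j '' tsupport (𝔄.ρ j)), ‖a j i i' x‖ ≤ Ka) ∧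
        (∀ j i i', HolderOnWith Ka α (a j i i')
          (Metric.thickening ρ₁ (𝔄.chart j '' tsupport (𝔄.ρ j)))) ∧
        (∀ j l' x, x ∈ Metric.thickening ρ₁ (𝔄.chart j '' tsupport (𝔄.ρ j)) → ‖b j l' x‖ ≤ Kb) ∧
        (∀ j l', HolderOnWith Kb α (b j l')
          (Metric.thickening ρ₁ (𝔄.chart j '' tsupport (𝔄.ρ j)))) ∧
        (∀ j, ∀ x ∈ Metric.thickening ρ₁ (𝔄.chart j '' tsupport (𝔄.ρ j)), ‖c j x‖ ≤ Kc) ∧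
        (∀ j, HolderOnWith Kc α (c j) (Metric.thickening ρ₁ (𝔄.chart j '' tsupport (𝔄.ρ j)))) ∧
        ∀ (L' : Literature.Analysis.FunctionSpaces.HolderManifoldFunction 𝔄 ℝ 2 α →L[ℝ]
            Literature.Analysis.FunctionSpaces.HolderManifoldFunction 𝔄 ℝ 0 α),
          (∀ (φ : Literature.Analysis.FunctionSpaces.HolderManifoldFunction 𝔄 ℝ 2 α) (x : M),
            L' φ x = Literature.Geometry.Riemannian.GurskyViaclovskyPath.linearisedBackgroundOperator
              g t w φ x + 4 * q x * Real.exp (-4 * w x) * φ x) →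
          ∀ (u : Literature.Analysis.FunctionSpaces.HolderManifoldFunction 𝔄 ℝ 2 α) (j : ι)
            (y : EuclideanSpace ℝ (Fin 4)),
            𝔄.piece ((-L') u) j y = 𝔄.piece (fun _ : M => (1 : ℝ)) j y *
              ((∑ i, ∑ i', a j i i' y * iteratedFDeriv ℝ 2
                  (Literature.Analysis.FunctionSpaces.chartRestrictCLM 𝔄 hα1.le j (𝔄.cutoff j)
                    (𝔄.contDiff_cutoff j) (𝔄.hasCompactSupport_cutoff j)
                    (𝔄.tsupport_cutoff_subset j) u : EuclideanSpace ℝ (Fin 4) → ℝ) y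
                  ![(EuclideanSpace.basisFun (Fin 4) ℝ) i, (EuclideanSpace.basisFun (Fin 4) ℝ) i']) +
                (∑ l', b j l' y * fderiv ℝ
                  (Literature.Analysis.FunctionSpaces.chartRestrictCLM 𝔄 hα1.le j (𝔄.cutoff j)
                    (𝔄.contDiff_cutoff j) (𝔄.hasCompactSupport_cutoff j)
                    (𝔄.tsupport_cutoff_subset j) u : EuclideanSpace ℝ (Fin 4) → ℝ) y
                  ((EuclideanSpace.basisFun (Fin 4) ℝ) l')) +
                c j y * (Literature.Analysis.FunctionSpaces.chartRestrictCLM 𝔄 hα1.le j (𝔄.cutoff j)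
                    (𝔄.contDiff_cutoff j) (𝔄.hasCompactSupport_cutoff j)
                    (𝔄.tsupport_cutoff_subset j) u) y) := by
  intro M _ _ _ _ _ ι _ 𝔄 g _ hg q hq hq0 α hα0 hα1 t ht w hw hpos heq
  classical
  have h1top : ((1 : ℕ) : WithTop ℕ∞) ≤ ((⊤ : ℕ∞) : WithTop ℕ∞) := WithTop.coe_le_coe.mpr le_top
  -- Step 1: closed thickenings `K'_j` of `K_j = chart_j(tsupport ρ_j)` on which `η_j = 1`
  obtain ⟨ρ₁, hρ₁, hη1⟩ := 𝔄.exists_cthickening_cutoff_eq_one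
  set K' : ι → Set (EuclideanSpace ℝ (Fin 4)) := fun j =>
    Metric.cthickening ρ₁ (𝔄.chart j '' tsupport (𝔄.ρ j)) with hK'
  have hK'c : ∀ j, IsCompact (K' j) := fun j => (𝔄.isCompact_image_tsupport j).1.cthickening
  have hK't : ∀ j, K' j ⊆ (𝔄.chart j).target := fun j y hy =>
    𝔄.mem_target_of_cutoff_ne_zero (by rw [hη1 j y hy]; exact one_ne_zero)
  have hthick : ∀ j, Metric.thickening ρ₁ (𝔄.chart j '' tsupport (𝔄.ρ j)) ⊆ K' j := fun j =>
    Metric.thickening_subset_cthickening _ _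
  -- Step 2: the chart coefficients of the linearisation at every chart centre
  choose A B Cc hA hB hCc hAsymm hApos hrep0 using fun j : ι =>
    exists_linearised_chartRep g hg hq hq0 ht hw hpos heq (𝔄.center j)
  have hl' : ∀ j, ∃ lam : ℝ, 0 < lam ∧ ∀ y ∈ K' j, ∀ ξ : Fin 4 → ℝ, lam * ∑ i, ξ i ^ 2 ≤
      ∑ i, ∑ i', A j i i' y * ξ i * ξ i' := fun j =>
    exists_ellipticity_const_of_continuousOn (hK'c j)
      (fun i i' => (hA j i i').continuousOn.mono (hK't j))
      (fun y hy ξ hξ => hApos j y (hK't j hy) ξ hξ)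
  choose lam hlam0 hlam using hl'
  obtain ⟨l, hl, hlle⟩ := exists_pos_forall_le_of_finite hlam0
  -- Step 3: the cut-off coefficients `η_j A_j`, `η_j B_j`, `η_j C_j` and their bounds
  set acoef : ι → Fin 4 → Fin 4 → EuclideanSpace ℝ (Fin 4) → ℝ := fun j i i' y =>
    𝔄.cutoff j y * A j i i' y with hacoef
  set bcoef : ι → Fin 4 → EuclideanSpace ℝ (Fin 4) → ℝ := fun j l' y =>
    𝔄.cutoff j y * B j l' y with hbcoef
  set ccoef : ι → EuclideanSpace ℝ (Fin 4) → ℝ := fun j y => 𝔄.cutoff j y * Cc j y with hccoef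
  have haS : ∀ j i i', ContDiff ℝ ∞ (acoef j i i') := fun j i i' =>
    ContDiffHolderFunction.contDiff_cutoff_mul (𝔄.contDiff_cutoff j) (𝔄.chart j).open_target
      (hA j i i') (𝔄.tsupport_cutoff_subset j)
  have hbS : ∀ j l', ContDiff ℝ ∞ (bcoef j l') := fun j l' =>
    ContDiffHolderFunction.contDiff_cutoff_mul (𝔄.contDiff_cutoff j) (𝔄.chart j).open_target
      (hB j l') (𝔄.tsupport_cutoff_subset j)
  have hcS : ∀ j, ContDiff ℝ ∞ (ccoef j) := fun j =>
    ContDiffHolderFunction.contDiff_cutoff_mul (𝔄.contDiff_cutoff j) (𝔄.chart j).open_target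
      (hCc j) (𝔄.tsupport_cutoff_subset j)
  choose Zs Zh hZ using fun j i i' => exists_bound_holderWith_of_hasCompactSupport
    ((haS j i i').of_le (by exact_mod_cast h1top))
    (ContDiffHolderFunction.hasCompactSupport_cutoff_mul (𝔄.hasCompactSupport_cutoff j) _) hα1.le
  choose Ws Wh hW using fun j l' => exists_bound_holderWith_of_hasCompactSupport
    ((hbS j l').of_le (by exact_mod_cast h1top))
    (ContDiffHolderFunction.hasCompactSupport_cutoff_mul (𝔄.hasCompactSupport_cutoff j) _) hα1.le
  choose Vs Vh hV using fun j => exists_bound_holderWith_of_hasCompactSupport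
    ((hcS j).of_le (by exact_mod_cast h1top))
    (ContDiffHolderFunction.hasCompactSupport_cutoff_mul (𝔄.hasCompactSupport_cutoff j) _) hα1.le
  set Ka : ℝ≥0 := Finset.univ.sup (fun p : ι × Fin 4 × Fin 4 =>
    Zs p.1 p.2.1 p.2.2 + Zh p.1 p.2.1 p.2.2) with hKa
  set Kb : ℝ≥0 := Finset.univ.sup (fun p : ι × Fin 4 => Ws p.1 p.2 + Wh p.1 p.2) with hKb
  set Kc : ℝ≥0 := Finset.univ.sup (fun j : ι => Vs j + Vh j) with hKc
  have hKa' : ∀ j i i', Zs j i i' ≤ Ka ∧ Zh j i i' ≤ Ka := fun j i i' => by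
    have h := Finset.le_sup
      (f := fun p : ι × Fin 4 × Fin 4 => Zs p.1 p.2.1 p.2.2 + Zh p.1 p.2.1 p.2.2)
      (Finset.mem_univ (j, i, i'))
    exact ⟨le_self_add.trans h, le_add_self.trans h⟩
  have hKb' : ∀ j l', Ws j l' ≤ Kb ∧ Wh j l' ≤ Kb := fun j l' => by
    have h := Finset.le_sup (f := fun p : ι × Fin 4 => Ws p.1 p.2 + Wh p.1 p.2)
      (Finset.mem_univ (j, l'))
    exact ⟨le_self_add.trans h, le_add_self.trans h⟩
  have hKc' : ∀ j, Vs j ≤ Kc ∧ Vh j ≤ Kc := fun j => by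
    have h := Finset.le_sup (f := fun j : ι => Vs j + Vh j) (Finset.mem_univ j)
    exact ⟨le_self_add.trans h, le_add_self.trans h⟩
  have ha0 : ∀ j i i' y, ‖acoef j i i' y‖ ≤ Ka := fun j i i' y =>
    ((hZ j i i').1 y).trans (NNReal.coe_le_coe.2 (hKa' j i i').1)
  have hsymm : ∀ j i i' y, acoef j i i' y = acoef j i' i y := fun j i i' y =>
    congrArg (fun s : ℝ => 𝔄.cutoff j y * s) (hAsymm j i i' y)
  have hlow : ∀ j, ∀ y ∈ Metric.thickening ρ₁ (𝔄.chart j '' tsupport (𝔄.ρ j)), ∀ ξ : Fin 4 → ℝ,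
      l * ∑ i, ξ i ^ 2 ≤ ∑ i, ∑ i', acoef j i i' y * ξ i * ξ i' := fun j y hy ξ => by
    have hyK : y ∈ K' j := hthick j hy
    calc l * ∑ i, ξ i ^ 2 ≤ lam j * ∑ i, ξ i ^ 2 :=
          mul_le_mul_of_nonneg_right (hlle j) (Finset.sum_nonneg fun i _ => sq_nonneg _)
      _ ≤ ∑ i, ∑ i', A j i i' y * ξ i * ξ i' := hlam j y hyK ξ
      _ = ∑ i, ∑ i', acoef j i i' y * ξ i * ξ i' := by simp only [hacoef, hη1 j y hyK, one_mul]
  have hup : ∀ j, ∀ y ∈ Metric.thickening ρ₁ (𝔄.chart j '' tsupport (𝔄.ρ j)), ∀ ξ : Fin 4 → ℝ,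
      ∑ i, ∑ i', acoef j i i' y * ξ i * ξ i' ≤ (Fintype.card (Fin 4) * Ka : ℝ) * ∑ i, ξ i ^ 2 :=
    fun j y _ ξ => quadratic_le_card_mul_of_abs_le
      (fun i i' => by rw [← Real.norm_eq_abs]; exact ha0 j i i' y) ξ
  have haH : ∀ j i i', HolderOnWith Ka α (acoef j i i')
      (Metric.thickening ρ₁ (𝔄.chart j '' tsupport (𝔄.ρ j))) := fun j i i' =>
    ((hZ j i i').2.mono (hKa' j i i').2).holderOnWith _
  have hb0 : ∀ j l' y, y ∈ Metric.thickening ρ₁ (𝔄.chart j '' tsupport (𝔄.ρ j)) →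
      ‖bcoef j l' y‖ ≤ Kb := fun j l' y _ =>
    ((hW j l').1 y).trans (NNReal.coe_le_coe.2 (hKb' j l').1)
  have hbH : ∀ j l', HolderOnWith Kb α (bcoef j l')
      (Metric.thickening ρ₁ (𝔄.chart j '' tsupport (𝔄.ρ j))) := fun j l' =>
    ((hW j l').2.mono (hKb' j l').2).holderOnWith _
  have hc0 : ∀ j, ∀ y ∈ Metric.thickening ρ₁ (𝔄.chart j '' tsupport (𝔄.ρ j)),
      ‖ccoef j y‖ ≤ Kc := fun j y _ =>
    ((hV j).1 y).trans (NNReal.coe_le_coe.2 (hKc' j).1)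
  have hcH : ∀ j, HolderOnWith Kc α (ccoef j)
      (Metric.thickening ρ₁ (𝔄.chart j '' tsupport (𝔄.ρ j))) := fun j =>
    ((hV j).2.mono (hKc' j).2).holderOnWith _
  refine ⟨acoef, bcoef, ccoef, ρ₁, l, Fintype.card (Fin 4) * Ka, Ka, Kb, Kc, hρ₁, hl, hsymm, hlow,
    hup, fun j i i' y _ => ha0 j i i' y, haH, hb0, hbH, hc0, hcH, ?_⟩
  -- Step 4: the chart-piece representation of `(-L') u`
  intro L' hL' u j y
  by_cases hy : y ∈ (𝔄.chart j).target
  · by_cases hρ : 𝔄.ρ j ((𝔄.chart j).symm y) = 0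
    · rw [𝔄.piece_apply_of_mem _ hy, 𝔄.piece_apply_of_mem _ hy, hρ, zero_smul, zero_smul,
        zero_mul]
    · -- near `y` the chart restriction is `u ∘ chart_j⁻¹` and `η_j = 1`
      have hR : ((chartRestrictCLM 𝔄 hα1.le j (𝔄.cutoff j) (𝔄.contDiff_cutoff j)
          (𝔄.hasCompactSupport_cutoff j) (𝔄.tsupport_cutoff_subset j) u :
            ContDiffHolderFunction (EuclideanSpace ℝ (Fin 4)) ℝ 2 α) :
              EuclideanSpace ℝ (Fin 4) → ℝ) =ᶠ[𝓝 y]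
          fun z => u ((𝔄.chart j).symm z) := by
        have h := chartRestrictCLM_eventuallyEq 𝔄 hα1.le u hρ
        rwa [(𝔄.chart j).right_inv hy] at h
      have hη : 𝔄.cutoff j y = 1 := by
        have h := (𝔄.cutoff_eventuallyEq_one hρ).self_of_nhds
        rwa [(𝔄.chart j).right_inv hy] at h
      have hR0 : (chartRestrictCLM 𝔄 hα1.le j (𝔄.cutoff j) (𝔄.contDiff_cutoff j)
          (𝔄.hasCompactSupport_cutoff j) (𝔄.tsupport_cutoff_subset j) u :
            ContDiffHolderFunction (EuclideanSpace ℝ (Fin 4)) ℝ 2 α) y =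
          u ((𝔄.chart j).symm y) := hR.self_of_nhds
      have hR1 := hR.fderiv_eq (𝕜 := ℝ)
      have hR2 := (Filter.EventuallyEq.iteratedFDeriv ℝ hR 2).self_of_nhds
      have key := hrep0 j u u.contMDiff y hy
      have hLu : ((-L') u) ((𝔄.chart j).symm y) = -(L' u ((𝔄.chart j).symm y)) := rfl
      rw [𝔄.piece_apply_of_mem _ hy, 𝔄.piece_apply_of_mem _ hy, hR2, hR1, hR0, hLu, hL' u, key]
      simp only [smul_eq_mul, mul_one, hacoef, hbcoef, hccoef, hη, one_mul]
  · rw [𝔄.piece_apply_of_not_mem _ hy, 𝔄.piece_apply_of_not_mem _ hy, zero_mul]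

end Summit.SmoothPoincare4.SmoothPoincare4.Theorems.MargerinRails

end
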